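import Literature.AnabelianGeometry.AbsoluteAnabelian.LocalVolumesNonarchimedean

/-!
# Kernel DAG index — layer L4, part a (MACHINE DRAFT by abc-iut-dag `tools/mkkernel.py`, index v0 of plan/DAG.tsv @2026-08-25T18:35Z, 1 nodes)

THIS FILE PROVES NOTHING NEW AND ASSERTS NOTHING (plan/KERNEL-DAG-SPEC.md). It gives ONE NAME `N_<kernel_id>` to each DAG node whose
statement has LANDED through the gate, knitting the landed declarations BY NAME; `N_<id>_holds` exists iff the node's printed claims are
theorems OUR kernel checked (it IS those theorems); FACT-style `def … : Prop` claims and `@[claim … "disputed"]` items get a name and no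
`_holds`. Nothing here says abc is proved or refuted or takes a side on [IUTchIII] Cor 3.12. typed ≠ discharged; indexed ≠ endorsed.
Filer of the tree copy: abc-iut-c312-2 (`Summits/ABC/IUTFork/DAGL4a.lean`); this draft is regenerated hourly and is not the tree.
FILED COPY (abc-iut-c312-2, post-processed by work/fixdraft.py): claim nodes are claim-form abbrevs without `_holds`;
`_holds` only for DAG rows marked discharged, `_part` otherwise (spec §2(b),(c)); edges by name (§3).
-/

namespace Summit.ABC.IUTFork.DAG

namespace PartL4a
/-- `StatementOf h` is the statement (a `Prop`) of which the landed `h` is the proof: the index NAMES statements, it never re-types them. -/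
abbrev StatementOf {P : Prop} (_h : P) : Prop := P
end PartL4a
open PartL4a

noncomputable section
universe u₁ u₂ u₃ u₄ u₅ u₆ u₇ u₈ u₉

/-- [node AbsTopIII:Prop5.7(i) · L4/D1 · [AbsTopIII] Prop 5.7 (i), kurims p.137 · p403734 · claim] decls 31 · cites→ AbsTopIII:Def3.1,AbsTopIII:Def4.1 -/
def N_AbsTopIII_Prop5_7_i : Prop :=
  StatementOf @Literature.AnabelianGeometry.AbsoluteAnabelian.mem_compactOpens.{u₁} ∧
  StatementOf @Literature.AnabelianGeometry.AbsoluteAnabelian.coe_integersPositiveCompacts.{u₁} ∧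
  StatementOf @Literature.AnabelianGeometry.AbsoluteAnabelian.isAddHaarMeasure_localHaar.{u₁} ∧
  StatementOf @Literature.AnabelianGeometry.AbsoluteAnabelian.localHaar_closedBall_one.{u₁} ∧
  StatementOf @Literature.AnabelianGeometry.AbsoluteAnabelian.localHaar_lt_top_of_mem.{u₁} ∧
  StatementOf @Literature.AnabelianGeometry.AbsoluteAnabelian.localHaar_pos_of_mem.{u₁} ∧
  StatementOf @Literature.AnabelianGeometry.AbsoluteAnabelian.localVolume_pos.{u₁} ∧
  StatementOf @Literature.AnabelianGeometry.AbsoluteAnabelian.localVolume_closedBall_one.{u₁} ∧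
  StatementOf @Literature.AnabelianGeometry.AbsoluteAnabelian.localVolume_union.{u₁} ∧
  StatementOf @Literature.AnabelianGeometry.AbsoluteAnabelian.localVolume_vadd.{u₁} ∧
  StatementOf @Literature.AnabelianGeometry.AbsoluteAnabelian.vadd_mem_compactOpens.{u₁} ∧
  StatementOf @Literature.AnabelianGeometry.AbsoluteAnabelian.localVolume_units_smul.{u₁}
/-- partial witness (DAG row not marked discharged) of `N_AbsTopIII_Prop5_7_i`: the landed theorems it names, BY NAME (spec §2(c)); proves nothing new. -/
theorem N_AbsTopIII_Prop5_7_i_part : N_AbsTopIII_Prop5_7_i := ⟨@Literature.AnabelianGeometry.AbsoluteAnabelian.mem_compactOpens, @Literature.AnabelianGeometry.AbsoluteAnabelian.coe_integersPositiveCompacts, @Literature.AnabelianGeometry.AbsoluteAnabelian.isAddHaarMeasure_localHaar, @Literature.AnabelianGeometry.AbsoluteAnabelian.localHaar_closedBall_one, @Literature.AnabelianGeometry.AbsoluteAnabelian.localHaar_lt_top_of_mem, @Literature.AnabelianGeometry.AbsoluteAnabelian.localHaar_pos_of_mem, @Literature.AnabelianGeometry.AbsoluteAnabelian.localVolume_pos,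 @Literature.AnabelianGeometry.AbsoluteAnabelian.localVolume_closedBall_one, @Literature.AnabelianGeometry.AbsoluteAnabelian.localVolume_union, @Literature.AnabelianGeometry.AbsoluteAnabelian.localVolume_vadd, @Literature.AnabelianGeometry.AbsoluteAnabelian.vadd_mem_compactOpens, @Literature.AnabelianGeometry.AbsoluteAnabelian.localVolume_units_smul⟩
-- (+8 further theorems of this node not conjoined in the draft)
example := @Literature.AnabelianGeometry.AbsoluteAnabelian.compactOpens
example := @Literature.AnabelianGeometry.AbsoluteAnabelian.integersPositiveCompacts
example := @Literature.AnabelianGeometry.AbsoluteAnabelian.localHaar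
example := @Literature.AnabelianGeometry.AbsoluteAnabelian.localVolume
example := @Literature.AnabelianGeometry.AbsoluteAnabelian.localLogVolume
example := @Literature.AnabelianGeometry.AbsoluteAnabelian.unitVolume

end

end Summit.ABC.IUTFork.DAG
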